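import Summits.QuantumFields.BalabanUV.Beta.AccretiveCombesThomasSandwichLocal
import Summits.QuantumFields.BalabanUV.Beta.MultiscaleDecay

/-!
# `Summit.QuantumFields.BalabanUV.Beta.AccretiveCombesThomasSandwichSite` — the `Q`-SANDWICH with LOCAL PREFACTORS along
# SITE WEIGHTS (one Combes–Thomas weight per TARGET block, thresholds instead of block-constancy), the REAL-OPERATOR bridge,
# and the INSTANCE on beta-d4-p2's multi-region MODEL operator `levelOp` (`MultiscaleDecay.hc_levelOp`)

HONEST FRAMING (page 1 of everything in this cell).  Discharging `FlowStep.BetaPertH` would make Bałaban's ultraviolet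
stability UNCONDITIONAL — a constructive-QFT result; it is NOT the continuum limit and NOT the Clay problem.  This module
discharges nothing of `BetaPertH`; [folklore] linear algebra, kernel-checked (unit `b2b-balaban-beta-d4-p3`, road P3, gen 10;
beta-d4-p2-g8's GO journal l.19202; cross-read C-d4p3-31; claim «SANDWICH-SITE» l.19277).  HONEST DEPENDENCY: continuum YM
on T⁴ ⇐ BetaPertH ∧ nine spine estimates (0/9 proved); BetaPertH ⇐ (D1) ∧ (D4) ∧ CAP+tail; G-an2-4 gates asym, D1 and NE2/3/4.

WHY THIS FILE.  K3 `AccretiveCombesThomasSandwichLocal` (p229851) bounds the sandwich entry `q_y^* A⁻¹ q_{y′}` from LOCAL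
conjugated coercivity along the BLOCK-CONSTANT weights `x ↦ D(blk x, y′)`.  The MODEL decay instance (L2)
`MultiscaleDecay.hc_levelOp` (p230877) is along the SITE weight `x ↦ κ·d_n(x, y₁)`, and a block-constant weight is NOT admissible
there (it jumps by `≍ 1` across a cell face; `MultiscaleDecayBudget.bond_budget_le` allows `κ·min(1∕n)`) — XREAD C-d4p3-31 INFO-2.
This file is the junction: §1 `conjForm_sub_const` + **`norm_sandwich_inv_le_site`** (ONE weight `ρ_{y′}` per target block,
THRESHOLDS `ρ_{y′} ≤ δ` on block `y′`, `ρ_{y′} ≥ D(y,y′) − δ` on block `y` ⟹ `|q_y^* A⁻¹ q_{y′}| ≤ e^{−κ(D−2δ)}·√(Σ‖q_y‖²∕μ)·√(Σ‖q_{y′}‖²∕μ)`,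
an4's `combesThomas_local` BY NAME after a constant shift); §2 block-constant PROFILES (`…_siteBlock`: `N·e^{−κ(D−2δ)}∕√(ν_yν_{y′})`;
`…_siteFloor`); §3 `wrs_sandwich_inv_siteFloor`; §4 the (2.16)-shape family END `wrs_sandwich_sub_zero_site`; §5 the REAL bridge
`localConjCoercive_cmat_of_pairing` (the MODEL's pairing hypothesis on real vectors IS §1's hypothesis for `cmat A`; owner's
`localConjCoercive_of_real` + `realConjForm_toMatrix'` BY NAME); §6 THE INSTANCE over (L2) BY NAME — blocks = cells (`cellOf`),
profile `μ₀·S_{l_k}⁻²`, weights `d_n(·, t_{k′})` to the cell CORNERS `t_k`, thresholds `δ = 2d` (`sdist_corner_thresholds`, from (K)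
`abs_sdist_sub_sdist_le_of_blk` on pv21's `torusComb`), `D(k,k′) = d_n(t_k,t_{k′})`: **`norm_cellSandwich_levelOp_inv_le`**
(`|q_k^*(cmat levelOp)⁻¹q_{k′}| ≤ Nq·e^{−κ(d_n(t_k,t_{k′}) − 4d)}·S_{l_k}S_{l_{k′}}∕μ₀`) and **`wrs_cellSandwich_levelOp`** (WRS with the floor at
the TOP scale) — the cell-lattice ℓ²-PAIRING ∕ (2.16) currency of [B9] Thm 3.1 (3.42)'s local-prefactor shape; print's (3.42)
p. 397 is a sup-norm bound (locator; the ℓ² → ℓ^∞ device is NOT here).  NOT HERE: Dirichlet holes ((w3), beta-d4-p2), Bałaban's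
`Q`, regions, vector operators (items (i)(ii)), NODE A's RowData junction (α) (row owner an4) — handed the WRS bound by name.

ABSOLUTE RULE.  Nothing printed is cited as a fact; (3.24)∕(3.42)∕(2.46)∕(2.16) are LOCATORS of shapes.  Nothing of other
lineages restated (BY NAME: an4 `combesThomas_local`∕`isUnit_of_localConjCoercive`∕`localConjCoercive_of_real`∕`realConjForm_toMatrix'`;
beta-d4-p2 `hc_levelOp`∕`cellOf`∕`siteScale`∕`sdist`∕`cmat`; b13 `WRS.*`; this lineage's `sandwich`, K3's bookkeeping lemmas).
Row D4: O.2 item (v)'s MODEL decay now reaches the (2.16) sandwich consumers with local prefactors; class of (T3) ∕ NODE O.2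
UNCHANGED (critical-path width 0); D4 DISCHARGE NO DATE; NOT BetaPertH, NOT continuum, NOT Clay, NOT summit progress.
-/

open scoped BigOperators Matrix ComplexConjugate
open Finset Complex Matrix Metric

namespace Summit.QuantumFields.BalabanUV.Beta.AccretiveCombesThomasSandwichSite

open Summit.QuantumFields.BalabanUV.Beta.AccretiveCombesThomas
open Summit.QuantumFields.BalabanUV.Beta.AccretiveCombesThomasSandwich (sandwich differentiableOn_sandwich)
open Summit.QuantumFields.BalabanUV.Beta.AccretiveCombesThomasSandwichLocal (sum_inv_mul_norm_sq_eq sqrt_inv_mul_mul_le)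
open Summit.QuantumFields.BalabanUV.Beta.MultiscaleCombesThomas (combesThomas_local isUnit_of_localConjCoercive)
open Summit.QuantumFields.BalabanUV.Beta.MultiscaleCombesThomasBudget (localConjCoercive_of_real realConjForm_toMatrix')
open Literature.MathematicalPhysics.QuantumFieldTheory.Balaban1983to89.B5Prop11Lower (nsq nsq_nonneg)
open Literature.MathematicalPhysics.QuantumFieldTheory.Balaban1983to89.B13PerturbativeStep (WRS)
open Literature.MathematicalPhysics.QuantumFieldTheory.Balaban1983to89
  (B13PerturbativeStep.WRS.of_entrywise B13PerturbativeStep.WRS.sub_apply_zero_of_differentiableOn)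

noncomputable section

variable {X Y : Type*} [Fintype X] [DecidableEq X] [Fintype Y]

/-! ## §1 The conjugated form sees only weight differences; the sandwich entry along SITE weights with thresholds -/

omit [DecidableEq X] in
/-- Shifting the Combes–Thomas weight by a constant does not change the conjugated form (`e^{κ(ρ_e−ρ_{e′})}` only). [folklore] -/
theorem conjForm_sub_const (A : Matrix X X ℂ) (κ : ℝ) (ρ : X → ℝ) (δ : ℝ) (z : X → ℂ) :
    conjForm A κ (fun x => ρ x - δ) z = conjForm A κ ρ z := by
  unfold conjForm
  simp only [sub_sub_sub_cancel_right]

omit [Fintype Y] in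
/-- **The `Q`-sandwich entry along SITE weights.**  One weight `ρ_{y′} : X → ℝ` per target block `y′`, with thresholds
`ρ_{y′} ≤ δ` on block `y′` and `ρ_{y′} ≥ D(y,y′) − δ` on block `y`; `A` locally conjugated-coercive with the fine-site profile
`μ > 0` along every `ρ_{y′}` (rate `κ ≥ 0`); `q_y` supported in block `y`.  Then
`|q_y^* A⁻¹ q_{y′}| ≤ e^{−κ(D(y,y′) − 2δ)}·√(Σ_x ‖q_y(x)‖²∕μ_x)·√(Σ_x ‖q_{y′}(x)‖²∕μ_x)` — an4's `combesThomas_local` BY NAME along the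
shifted weight `ρ_{y′} − δ` (`≤ 0` on block `y′`, `≥ D − 2δ` on block `y`). [folklore] -/
theorem norm_sandwich_inv_le_site (A : Matrix X X ℂ) (blk : X → Y) (D : Y → Y → ℝ) (ρ : Y → X → ℝ) (δ : ℝ)
    (hρ0 : ∀ y' x, blk x = y' → ρ y' x ≤ δ) (hρD : ∀ y y' x, blk x = y → D y y' - δ ≤ ρ y' x)
    (q : Y → X → ℂ) (hq : ∀ y x, blk x ≠ y → q y x = 0) {κ : ℝ} {μ : X → ℝ} (hκ : 0 ≤ κ) (hμ : ∀ x, 0 < μ x)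
    (hc : ∀ y', ∀ z : X → ℂ, ∑ x, μ x * ‖z x‖ ^ 2 ≤ (conjForm A κ (ρ y') z).re) (y y' : Y) :
    ‖star (q y) ⬝ᵥ (A⁻¹ *ᵥ q y')‖ ≤ Real.exp (-(κ * (D y y' - 2 * δ))) *
      (Real.sqrt (∑ x, (μ x)⁻¹ * ‖q y x‖ ^ 2) * Real.sqrt (∑ x, (μ x)⁻¹ * ‖q y' x‖ ^ 2)) := by
  have hAu : IsUnit A := isUnit_of_localConjCoercive hμ (hc y')
  have hdet : IsUnit A.det := (Matrix.isUnit_iff_isUnit_det A).mp hAu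
  have hx : A *ᵥ (A⁻¹ *ᵥ q y') = q y' := by
    rw [Matrix.mulVec_mulVec, Matrix.mul_nonsing_inv A hdet, Matrix.one_mulVec]
  have hc' : ∀ z : X → ℂ, ∑ x, μ x * ‖z x‖ ^ 2 ≤ (conjForm A κ (fun x => ρ y' x - δ) z).re := fun z => by
    rw [conjForm_sub_const]; exact hc y' z
  exact combesThomas_local (fun x => ρ y' x - δ) hμ hκ hc' hx
    (fun x hx' => by
      by_cases hb : blk x = y
      · have h := hρD y y' x hb
        show D y y' - 2 * δ ≤ ρ y' x - δ
        linarith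
      · exact absurd (hq y x hb) hx')
    (fun x hx' => by
      by_cases hb : blk x = y'
      · have h := hρ0 y' x hb
        show ρ y' x - δ ≤ 0
        linarith
      · exact absurd (hq y' x hb) hx')

/-! ## §2 Block-constant PROFILES: the geometric-mean local prefactor, and a floor -/

omit [Fintype Y] in
/-- **The sandwich entry along site weights with the GEOMETRIC-MEAN local prefactor.**  Profile `x ↦ ν(blk x)`, `ν > 0`;
`‖q_y‖² ≤ N` ⟹ `|q_y^* A⁻¹ q_{y′}| ≤ N·e^{−κ(D(y,y′) − 2δ)}∕√(ν_y ν_{y′})`.  For the multi-region operator `ν_y = μ₀·(L^{j(y)}η)⁻²`: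
the prefactor `(L^{j(y)}η)(L^{j(y′)}η)∕μ₀` — the ENTRY ∕ ℓ²-pairing currency of (3.42)'s local-prefactor SHAPE (locator; print's
(3.42) is a sup-norm bound). [cite: Balaban1985BackgroundPropagators, Thm 3.1 (3.42) p.397] [folklore] -/
theorem norm_sandwich_inv_le_siteBlock (A : Matrix X X ℂ) (blk : X → Y) (D : Y → Y → ℝ) (ρ : Y → X → ℝ) (δ : ℝ)
    (hρ0 : ∀ y' x, blk x = y' → ρ y' x ≤ δ) (hρD : ∀ y y' x, blk x = y → D y y' - δ ≤ ρ y' x)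
    (q : Y → X → ℂ) (hq : ∀ y x, blk x ≠ y → q y x = 0) {N : ℝ} (hN : ∀ y, nsq (q y) ≤ N)
    {κ : ℝ} {ν : Y → ℝ} (hκ : 0 ≤ κ) (hν : ∀ y, 0 < ν y)
    (hc : ∀ y', ∀ z : X → ℂ, ∑ x, ν (blk x) * ‖z x‖ ^ 2 ≤ (conjForm A κ (ρ y') z).re) (y y' : Y) :
    ‖star (q y) ⬝ᵥ (A⁻¹ *ᵥ q y')‖ ≤ N * Real.exp (-(κ * (D y y' - 2 * δ))) / Real.sqrt (ν y * ν y') := by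
  have h := norm_sandwich_inv_le_site A blk D ρ δ hρ0 hρD q hq hκ (μ := fun x => ν (blk x)) (fun x => hν (blk x)) hc y y'
  rw [sum_inv_mul_norm_sq_eq blk ν q hq y, sum_inv_mul_norm_sq_eq blk ν q hq y'] at h
  have hsq := sqrt_inv_mul_mul_le (hν y) (hν y') (nsq_nonneg (q y)) (nsq_nonneg (q y')) (hN y) (hN y')
  calc ‖star (q y) ⬝ᵥ (A⁻¹ *ᵥ q y')‖
      ≤ Real.exp (-(κ * (D y y' - 2 * δ))) *
          (Real.sqrt ((ν y)⁻¹ * nsq (q y)) * Real.sqrt ((ν y')⁻¹ * nsq (q y'))) := h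
    _ ≤ Real.exp (-(κ * (D y y' - 2 * δ))) * (N / Real.sqrt (ν y * ν y')) :=
        mul_le_mul_of_nonneg_left hsq (Real.exp_pos _).le
    _ = N * Real.exp (-(κ * (D y y' - 2 * δ))) / Real.sqrt (ν y * ν y') := by ring

omit [Fintype Y] in
/-- **With a floor** `ν ≥ ν₀ > 0`: `|q_y^* A⁻¹ q_{y′}| ≤ (N∕ν₀)·e^{2κδ}·e^{−κD(y,y′)}`.  For the multi-region operator the floor is
attained at the TOP scale (`ν₀ = μ₀(L^kη)⁻²`) — `k`-uniform, reached through the LOCAL engine only. [folklore] -/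
theorem norm_sandwich_inv_le_siteFloor (A : Matrix X X ℂ) (blk : X → Y) (D : Y → Y → ℝ) (ρ : Y → X → ℝ) (δ : ℝ)
    (hρ0 : ∀ y' x, blk x = y' → ρ y' x ≤ δ) (hρD : ∀ y y' x, blk x = y → D y y' - δ ≤ ρ y' x)
    (q : Y → X → ℂ) (hq : ∀ y x, blk x ≠ y → q y x = 0) {N : ℝ} (hN : ∀ y, nsq (q y) ≤ N)
    {κ ν₀ : ℝ} {ν : Y → ℝ} (hκ : 0 ≤ κ) (hν0 : 0 < ν₀) (hfl : ∀ y, ν₀ ≤ ν y)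
    (hc : ∀ y', ∀ z : X → ℂ, ∑ x, ν (blk x) * ‖z x‖ ^ 2 ≤ (conjForm A κ (ρ y') z).re) (y y' : Y) :
    ‖star (q y) ⬝ᵥ (A⁻¹ *ᵥ q y')‖ ≤ N / ν₀ * Real.exp (2 * κ * δ) * Real.exp (-(κ * D y y')) := by
  have hν : ∀ y, 0 < ν y := fun y => hν0.trans_le (hfl y)
  have h := norm_sandwich_inv_le_siteBlock A blk D ρ δ hρ0 hρD q hq hN hκ hν hc y y'
  have hN0 : 0 ≤ N := (nsq_nonneg _).trans (hN y)
  have hfloor : ν₀ ≤ Real.sqrt (ν y * ν y') := by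
    rw [show ν₀ = Real.sqrt (ν₀ * ν₀) from (Real.sqrt_mul_self hν0.le).symm]
    exact Real.sqrt_le_sqrt (mul_le_mul (hfl y) (hfl y') hν0.le (hν y).le)
  have hexp : Real.exp (-(κ * (D y y' - 2 * δ))) = Real.exp (2 * κ * δ) * Real.exp (-(κ * D y y')) := by
    rw [← Real.exp_add]; ring_nf
  calc ‖star (q y) ⬝ᵥ (A⁻¹ *ᵥ q y')‖ ≤ N * Real.exp (-(κ * (D y y' - 2 * δ))) / Real.sqrt (ν y * ν y') := h
    _ ≤ N * Real.exp (-(κ * (D y y' - 2 * δ))) / ν₀ :=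
        div_le_div_of_nonneg_left (mul_nonneg hN0 (Real.exp_pos _).le) hν0 hfloor
    _ = N / ν₀ * Real.exp (2 * κ * δ) * Real.exp (-(κ * D y y')) := by rw [hexp]; ring

/-! ## §3 Weighted row sums of the sandwich matrix along site weights -/

/-- **WRS of the sandwich with a floor, site-weight form**: `Σ_{y′} e^{−(κ−κ′)D(y,y′)} ≤ L` ⟹
`WRS κ′ D (sandwich A q) (N∕ν₀·e^{2κδ}·L)` (`WRS.of_entrywise` BY NAME). [folklore] -/
theorem wrs_sandwich_inv_siteFloor (A : Matrix X X ℂ) (blk : X → Y) (D : Y → Y → ℝ) (ρ : Y → X → ℝ) (δ : ℝ)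
    (hρ0 : ∀ y' x, blk x = y' → ρ y' x ≤ δ) (hρD : ∀ y y' x, blk x = y → D y y' - δ ≤ ρ y' x)
    (q : Y → X → ℂ) (hq : ∀ y x, blk x ≠ y → q y x = 0) {N : ℝ} (hN0 : 0 ≤ N) (hN : ∀ y, nsq (q y) ≤ N)
    {κ κ' ν₀ L : ℝ} {ν : Y → ℝ} (hκ : 0 ≤ κ) (hν0 : 0 < ν₀) (hfl : ∀ y, ν₀ ≤ ν y)
    (hc : ∀ y', ∀ z : X → ℂ, ∑ x, ν (blk x) * ‖z x‖ ^ 2 ≤ (conjForm A κ (ρ y') z).re)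
    (hL : ∀ y, ∑ y', Real.exp (-((κ - κ') * D y y')) ≤ L) :
    WRS κ' D (sandwich A q) (N / ν₀ * Real.exp (2 * κ * δ) * L) :=
  B13PerturbativeStep.WRS.of_entrywise (θ := N / ν₀ * Real.exp (2 * κ * δ))
    (mul_nonneg (div_nonneg hN0 hν0.le) (Real.exp_pos _).le)
    (fun y y' => norm_sandwich_inv_le_siteFloor A blk D ρ δ hρ0 hρD q hq hN hκ hν0 hfl hc y y') hL

/-! ## §4 The sandwiched inverse FAMILY under uniform local coercivity along site weights: (2.16)-shape END -/

/-- **(2.16)-shape for SANDWICHED inverse families, site-weight form.**  `σ ↦ A(σ)` entrywise holomorphic on `|σ| < R` and,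
for every `σ` there, locally conjugated-coercive with the block-constant profile `ν ≥ ν₀ > 0` along every site weight `ρ_{y′}`
(thresholds `δ`); `q_y` supported in block `y`, `‖q_y‖² ≤ N`; `Σ_{y′} e^{−(κ−κ′)D(y,y′)} ≤ L`.  Then on the disc
`WRS κ′ D (S_σ − S_0) (2(N∕ν₀·e^{2κδ}·L)∕R·‖σ‖)`, `S_σ = sandwich (A σ) q` (`WRS.sub_apply_zero_of_differentiableOn` BY NAME).
[cite: Balaban1988RG2Cluster, (2.16) p.16] [folklore] -/
theorem wrs_sandwich_sub_zero_site [Nonempty Y] {A : ℂ → Matrix X X ℂ} (blk : X → Y) (D : Y → Y → ℝ)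
    (ρ : Y → X → ℝ) (δ : ℝ) (hρ0 : ∀ y' x, blk x = y' → ρ y' x ≤ δ) (hρD : ∀ y y' x, blk x = y → D y y' - δ ≤ ρ y' x)
    (q : Y → X → ℂ) (hq : ∀ y x, blk x ≠ y → q y x = 0) {N : ℝ} (hN0 : 0 ≤ N) (hN : ∀ y, nsq (q y) ≤ N)
    {κ κ' ν₀ R L : ℝ} {ν : Y → ℝ} (hR : 0 < R) (hκ : 0 ≤ κ) (hν0 : 0 < ν₀) (hfl : ∀ y, ν₀ ≤ ν y)
    (ha : ∀ i j, DifferentiableOn ℂ (fun σ => A σ i j) (ball 0 R))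
    (hc : ∀ σ ∈ ball (0 : ℂ) R, ∀ y', ∀ z : X → ℂ, ∑ x, ν (blk x) * ‖z x‖ ^ 2 ≤ (conjForm (A σ) κ (ρ y') z).re)
    (hL : ∀ y, ∑ y', Real.exp (-((κ - κ') * D y y')) ≤ L) {σ : ℂ} (hσ : σ ∈ ball (0 : ℂ) R) :
    WRS κ' D (sandwich (A σ) q - sandwich (A 0) q) (2 * (N / ν₀ * Real.exp (2 * κ * δ) * L) / R * ‖σ‖) := by
  have hν : ∀ y, 0 < ν y := fun y => hν0.trans_le (hfl y)
  have hU : ∀ τ ∈ ball (0 : ℂ) R, IsUnit (A τ) := fun τ hτ =>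
    isUnit_of_localConjCoercive (μ := fun x => ν (blk x)) (fun x => hν (blk x)) (hc τ hτ (Classical.arbitrary Y))
  have ha' : ∀ y y', DifferentiableOn ℂ (fun τ => sandwich (A τ) q y y') (ball 0 R) :=
    fun y y' => differentiableOn_sandwich ha hU q y y'
  have hm' : ∀ τ ∈ ball (0 : ℂ) R, ∀ y y',
      ‖sandwich (A τ) q y y'‖ ≤ N / ν₀ * Real.exp (2 * κ * δ) * Real.exp (-(κ * D y y')) :=
    fun τ hτ y y' => norm_sandwich_inv_le_siteFloor (A τ) blk D ρ δ hρ0 hρD q hq hN hκ hν0 hfl (hc τ hτ) y y'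
  have hρ' : ∀ y, ∑ y', N / ν₀ * Real.exp (2 * κ * δ) * Real.exp (-(κ * D y y')) * Real.exp (κ' * D y y') ≤
      N / ν₀ * Real.exp (2 * κ * δ) * L := by
    intro y
    calc ∑ y', N / ν₀ * Real.exp (2 * κ * δ) * Real.exp (-(κ * D y y')) * Real.exp (κ' * D y y')
        = N / ν₀ * Real.exp (2 * κ * δ) * ∑ y', Real.exp (-((κ - κ') * D y y')) := by
          rw [Finset.mul_sum]
          refine Finset.sum_congr rfl fun y' _ => ?_
          rw [mul_assoc, ← Real.exp_add]
          ring_nf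
      _ ≤ N / ν₀ * Real.exp (2 * κ * δ) * L :=
          mul_le_mul_of_nonneg_left (hL y) (mul_nonneg (div_nonneg hN0 hν0.le) (Real.exp_pos _).le)
  exact B13PerturbativeStep.WRS.sub_apply_zero_of_differentiableOn (A := fun τ => sandwich (A τ) q) hR ha' hm' hρ' hσ

/-! ## §5 The REAL-OPERATOR bridge: the MODEL's pairing hypothesis IS §1's hypothesis for `cmat A` -/

/-- **Real endomorphisms.**  For `A : Module.End ℝ (X → ℝ)` and a weight `ρ`, the MODEL-currency hypothesis
`Σ_p μ_p v_p² ≤ Σ_p e^{κρ_p}v_p·(A(e^{−κρ}v))_p` on REAL vectors gives §1's complex hypothesis for the matrix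
`(toMatrix′ A).map ofReal` (= beta-d4-p2's `CovariantTowerMatrix.cmat A` by `rfl`) — the row owner's `realConjForm_toMatrix'` +
`localConjCoercive_of_real` BY NAME. [folklore] -/
theorem localConjCoercive_cmat_of_pairing (A : Module.End ℝ (X → ℝ)) {κ : ℝ} (ρ : X → ℝ) {μ : X → ℝ}
    (hc : ∀ v : X → ℝ, ∑ p, μ p * v p ^ 2 ≤ ∑ p, Real.exp (κ * ρ p) * v p * A (fun q => Real.exp (-(κ * ρ q)) * v q) p)
    (z : X → ℂ) :
    ∑ x, μ x * ‖z x‖ ^ 2 ≤ (conjForm ((LinearMap.toMatrix' A).map Complex.ofRealHom) κ ρ z).re := by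
  refine localConjCoercive_of_real _ (fun w => ?_) z
  rw [realConjForm_toMatrix']
  exact hc w

/-! ## §6 THE INSTANCE: the cell-lattice sandwich of beta-d4-p2's multi-region MODEL operator `levelOp` -/

section Instance

open Summit.QuantumFields.BalabanUV.Beta.BoxPoincare (Box)
open Summit.QuantumFields.BalabanUV.Beta.MultiscaleCoerciveTorus
open Summit.QuantumFields.BalabanUV.Beta.MultiscaleDistance
open Summit.QuantumFields.BalabanUV.Beta.MultiscaleDecayBudget
open Summit.QuantumFields.BalabanUV.Beta.MultiscaleDecay (hc_levelOp)
open Summit.QuantumFields.BalabanUV.Beta.CovariantTowerMatrix (cmat)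
open Literature.MathematicalPhysics.QuantumFieldTheory.Balaban1983to89
open Literature.MathematicalPhysics.QuantumFieldTheory.Balaban1983to89.B9Thm37GluePU (bsrc btgt)
open Literature.MathematicalPhysics.QuantumFieldTheory.Balaban1983to89.B9Thm37GlueTorusCov (tblk torusComb)
open Literature.MathematicalPhysics.QuantumFieldTheory.Balaban1983to89.B9Thm37GlueTorusCovPoinc (tdepth_le)
open Literature.MathematicalPhysics.QuantumFieldTheory.Balaban1983to89.B9Thm37GlueTorusCovLevels (levelOp)
open B5TorusCover (UT Ctr ctrU)

variable {d : ℕ} {N : Fin d → ℕ} [∀ i, NeZero (N i)] [NeZero d] {Cp J K : Type} [Fintype Cp] [DecidableEq Cp] [Nonempty Cp]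
  [Fintype J] [Fintype K] (S : J → ℕ) (hS : ∀ l, 1 ≤ S l) (hdivS : ∀ l i, S l ∣ N i) (lvl : K → J)
  (zc : (k : K) → Ctr N (S (lvl k)))

omit [Fintype Cp] [DecidableEq Cp] [Nonempty Cp] [Fintype J] [Fintype K] in
/-- **Oscillation of the distance to a fixed target over one cell**: for a site `x` of cell `k` (`cellOf x = k`) and the cell
corner `t_k = ctrU (zc k)`, `|d_n(x, j) − d_n(t_k, j)| ≤ 2d` — (K) `abs_sdist_sub_sdist_le_of_blk` on the torus comb of level
`l_k` (depth `≤ d(S−1)`, scale `S` on the whole block), with `2d(S−1)∕S ≤ 2d`. [folklore] -/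
theorem abs_sdist_sub_corner_le (hdisj : ∀ k k' v v', cellPt S hS hdivS lvl zc k v = cellPt S hS hdivS lvl zc k' v' → k = k')
    (hcover : ∀ x : UT N, ∃ k, ∃ v : Box d (S (lvl k)), cellPt S hS hdivS lvl zc k v = x) (x j : UT N) :
    |sdist bsrc btgt (siteScale S hS hdivS lvl zc hcover) x j -
        sdist bsrc btgt (siteScale S hS hdivS lvl zc hcover)
          (ctrU N (S (lvl (cellOf S hS hdivS lvl zc hcover x))) (zc (cellOf S hS hdivS lvl zc hcover x))) j| ≤ 2 * d := by
  set n := siteScale S hS hdivS lvl zc hcover with hn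
  set k := cellOf S hS hdivS lvl zc hcover x with hk
  -- every site of the torus block `zc k` (level `l_k`) is a site of cell `k`, hence has scale `S (lvl k)`
  have hscale : ∀ z, tblk (hS (lvl k)) (hdivS (lvl k)) z = zc k → n z = S (lvl k) := by
    intro z hz
    obtain ⟨v, hv⟩ := (tblk_eq_iff (hS (lvl k)) (hdivS (lvl k)) z (zc k)).mp hz
    rw [hn, ← hv]
    exact siteScale_cellPt S hS hdivS lvl zc hdisj hcover k v
  -- `x` and the corner lie in the block `zc k`
  have hx : tblk (hS (lvl k)) (hdivS (lvl k)) x = zc k := by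
    obtain ⟨v, hv⟩ := cellOf_spec S hS hdivS lvl zc hcover x
    have h2 := tblk_cubePt (hS (lvl k)) (hdivS (lvl k)) (zc k) v
    have hv' : cubePt (hS (lvl k)) (hdivS (lvl k)) (zc k) v = x := hv
    rwa [hv'] at h2
  have ht : tblk (hS (lvl k)) (hdivS (lvl k)) (ctrU N (S (lvl k)) (zc k)) = zc k := by
    rw [← cubePt_zero (hS (lvl k)) (hdivS (lvl k)) (zc k)]
    exact tblk_cubePt _ _ (zc k) _
  have h := abs_sdist_sub_sdist_le_of_blk bsrc btgt n (torusComb (hS (lvl k)) (hdivS (lvl k))) (β := zc k)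
    (S := S (lvl k)) (D := d * (S (lvl k) - 1)) (fun z hz => hscale z hz) (fun z _ => tdepth_le (hS (lvl k)) z) j hx ht
  refine h.trans ?_
  have hS1 : (1 : ℝ) ≤ S (lvl k) := by exact_mod_cast hS (lvl k)
  have hsub : ((d * (S (lvl k) - 1) : ℕ) : ℝ) ≤ d * (S (lvl k) : ℝ) := by
    have : d * (S (lvl k) - 1) ≤ d * S (lvl k) := Nat.mul_le_mul_left d (Nat.sub_le _ _)
    exact_mod_cast this
  calc 2 * ((d * (S (lvl k) - 1) : ℕ) : ℝ) * (S (lvl k) : ℝ)⁻¹ ≤ 2 * (d * (S (lvl k) : ℝ)) * (S (lvl k) : ℝ)⁻¹ :=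
        mul_le_mul_of_nonneg_right (mul_le_mul_of_nonneg_left hsub (by norm_num)) (inv_nonneg.mpr (by positivity))
    _ = 2 * d := by field_simp

omit [Fintype Cp] [DecidableEq Cp] [Nonempty Cp] [Fintype J] [Fintype K] in
/-- **Thresholds on the cells.**  With `t_k = ctrU (zc k)` the cell corners: a site `x` of cell `k′` has `d_n(x, t_{k′}) ≤ 2d`, and a
site `x` of cell `k` has `d_n(t_k, t_{k′}) − 2d ≤ d_n(x, t_{k′})` — the two threshold hypotheses of §1 for the site weights
`ρ_{k′} = d_n(·, t_{k′})`, `δ = 2d`, `D(k,k′) = d_n(t_k, t_{k′})` (`abs_sdist_sub_corner_le` + `sdist_self`). [folklore] -/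
theorem sdist_corner_thresholds (hdisj : ∀ k k' v v', cellPt S hS hdivS lvl zc k v = cellPt S hS hdivS lvl zc k' v' → k = k')
    (hcover : ∀ x : UT N, ∃ k, ∃ v : Box d (S (lvl k)), cellPt S hS hdivS lvl zc k v = x) (x : UT N) (k' : K) :
    (cellOf S hS hdivS lvl zc hcover x = k' →
        sdist bsrc btgt (siteScale S hS hdivS lvl zc hcover) x (ctrU N (S (lvl k')) (zc k')) ≤ 2 * d) ∧
      (sdist bsrc btgt (siteScale S hS hdivS lvl zc hcover)
            (ctrU N (S (lvl (cellOf S hS hdivS lvl zc hcover x))) (zc (cellOf S hS hdivS lvl zc hcover x)))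
            (ctrU N (S (lvl k')) (zc k')) - 2 * d ≤
        sdist bsrc btgt (siteScale S hS hdivS lvl zc hcover) x (ctrU N (S (lvl k')) (zc k'))) := by
  have h := abs_sdist_sub_corner_le S hS hdivS lvl zc hdisj hcover x (ctrU N (S (lvl k')) (zc k'))
  refine ⟨fun hx => ?_, by linarith [(abs_sub_le_iff.mp h).2]⟩
  subst hx
  rw [sdist_self] at h
  linarith [(abs_sub_le_iff.mp h).1]

/-! ### The analytic setting of (L2) `MultiscaleDecay.hc_levelOp`, as section variables -/

variable
    (hdisj : ∀ k k' v v', cellPt S hS hdivS lvl zc k v = cellPt S hS hdivS lvl zc k' v' → k = k')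
    (hcover : ∀ x : UT N, ∃ k, ∃ v : Box d (S (lvl k)), cellPt S hS hdivS lvl zc k v = x)
    (Rm : UT N × Fin d → Cp → Cp → ℝ) (hRm : ∀ b i j, ∑ k, Rm b k i * Rm b k j = if i = j then (1 : ℝ) else 0)
    (T : J → UT N → Cp → Cp → ℝ) (hT : ∀ l x i i', ∑ k, T l x k i * T l x k i' = if i = i' then (1 : ℝ) else 0)
    (a : J → ℝ) (ha : ∀ j, 0 ≤ a j) (ω : J → UT N → ℝ)
    (hsupp : ∀ l x, ω l (ctrU N (S l) (tblk (hS l) (hdivS l) x)) ≠ 0 → ∃ k v, lvl k = l ∧ cellPt S hS hdivS lvl zc k v = x)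
    {amax : ℝ} (hamax : 0 ≤ amax)
    (hscale : ∀ k, a (lvl k) * ω (lvl k) (ctrU N (S (lvl k)) (zc k)) ^ 2 * (S (lvl k) : ℝ) ^ d ≤ amax / (S (lvl k) : ℝ) ^ 2)
    (c : UT N × Fin d → ℝ) {cmax : ℝ} (hc : ∀ b, |c b| ≤ cmax) {C : ℝ}
    (hcoer : ∀ f : UT N × Cp → ℝ,
      C * ∑ k, ((S (lvl k) : ℝ) ^ 2)⁻¹ * ∑ v : Box d (S (lvl k)), ∑ i, f (cellPt S hS hdivS lvl zc k v, i) ^ 2 ≤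
        ∑ p, f p * levelOp bsrc btgt c Rm (fun l x => ctrU N (S l) (tblk (hS l) (hdivS l) x))
          (fun l x => ω l (ctrU N (S l) (tblk (hS l) (hdivS l) x))) T a f p)
    {κ : ℝ} (hκ0 : 0 ≤ κ) (hκ1 : κ ≤ 1)

include hdisj hRm hT ha hsupp hamax hscale hc hcoer hκ0 hκ1

/-- **The local conjugated coercivity of `cmat levelOp` along the site weight `κ·d_n(·, t)`** (any target site `t`), with the
CELL-CONSTANT profile `μ₀·S_{l(cell x)}⁻²` — beta-d4-p2's `hc_levelOp` BY NAME through §5's real bridge (the profile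
`μ₀·n(x)⁻²` IS cell-constant: `n = siteScale`). [folklore] -/
theorem localConjCoercive_cmat_levelOp (t : UT N) (z : UT N × Cp → ℂ) :
    ∑ p, (C - 2 * d * cmax ^ 2 * κ ^ 2 - amax * (Real.exp (2 * d * κ) - 1)) *
        ((S (lvl (cellOf S hS hdivS lvl zc hcover p.1)) : ℝ) ^ 2)⁻¹ * ‖z p‖ ^ 2 ≤
      (conjForm (cmat (levelOp bsrc btgt c Rm (fun l x => ctrU N (S l) (tblk (hS l) (hdivS l) x))
          (fun l x => ω l (ctrU N (S l) (tblk (hS l) (hdivS l) x))) T a)) κ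
        (fun p => sdist bsrc btgt (siteScale S hS hdivS lvl zc hcover) p.1 t) z).re := by
  obtain ⟨i₀⟩ := ‹Nonempty Cp›
  have hreal := fun v : UT N × Cp → ℝ =>
    hc_levelOp S hS hdivS lvl zc hdisj hcover Rm hRm T hT a ha ω hsupp hamax hscale c hc hcoer hκ0 hκ1 (t, i₀) v
  have h := localConjCoercive_cmat_of_pairing _ (fun p : UT N × Cp => sdist bsrc btgt (siteScale S hS hdivS lvl zc hcover) p.1 t)
    hreal z
  refine le_trans (le_of_eq (Finset.sum_congr rfl fun p _ => ?_)) h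
  rfl

/-- **THE CELL-LATTICE SANDWICH OF THE MULTI-REGION MODEL OPERATOR WITH LOCAL PREFACTORS.**  Setting of beta-d4-p2's
`MultiscaleDecay.hc_levelOp` (torus `UT N`; isometric `Rm`, `T`; `a ≥ 0`; level weights supported on the level-`l` cells of a
pairwise-disjoint COVERING cube family, print-size from above; `|c| ≤ c_max`; a cell-sum coercivity `C`; `0 ≤ κ ≤ 1` with
`μ₀ = C − 2d·c_max²κ² − a_max(e^{2dκ} − 1) > 0`).  Test vectors `q_k` on `UT N × Cp` supported in cell `k` (`cellOf`) with
`‖q_k‖² ≤ Nq`.  Then, with `t_k = ctrU (zc k)` the cell corners, `S_{l_k}` the cell sides and `d_n` the scale-adapted distance,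
`|q_k^* (cmat levelOp)⁻¹ q_{k′}| ≤ Nq·e^{−κ(d_n(t_k, t_{k′}) − 2·(2d))} ∕ √((μ₀S_{l_k}⁻²)(μ₀S_{l_{k′}}⁻²))`
(`= Nq·e^{4κd}·e^{−κ d_n(t_k,t_{k′})}·S_{l_k}S_{l_{k′}}∕μ₀`) — the ℓ²-PAIRING ∕ sandwich currency of (3.42)'s local-prefactor SHAPE on
the cell lattice, constants seeing `d, c, a, C, κ` only (§2 + `sdist_corner_thresholds` + `localConjCoercive_cmat_levelOp`).  Print's
(3.42) p. 397 is a sup-norm bound (locator; the ℓ² → ℓ^∞ device is not here).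
[cite: Balaban1985BackgroundPropagators, (3.24) p.394 + Thm 3.1 (3.42) p.397; Balaban1984PropagatorsII, (2.46) p.231] [folklore] -/
theorem norm_cellSandwich_levelOp_inv_le (hμ : 0 < C - 2 * d * cmax ^ 2 * κ ^ 2 - amax * (Real.exp (2 * d * κ) - 1))
    (q : K → UT N × Cp → ℂ) (hq : ∀ k p, cellOf S hS hdivS lvl zc hcover p.1 ≠ k → q k p = 0) {Nq : ℝ}
    (hNq : ∀ k, nsq (q k) ≤ Nq) (k k' : K) :
    ‖star (q k) ⬝ᵥ ((cmat (levelOp bsrc btgt c Rm (fun l x => ctrU N (S l) (tblk (hS l) (hdivS l) x))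
        (fun l x => ω l (ctrU N (S l) (tblk (hS l) (hdivS l) x))) T a))⁻¹ *ᵥ q k')‖ ≤
      Nq * Real.exp (-(κ * (sdist bsrc btgt (siteScale S hS hdivS lvl zc hcover) (ctrU N (S (lvl k)) (zc k))
          (ctrU N (S (lvl k')) (zc k')) - 2 * (2 * d)))) /
        Real.sqrt ((C - 2 * d * cmax ^ 2 * κ ^ 2 - amax * (Real.exp (2 * d * κ) - 1)) * ((S (lvl k) : ℝ) ^ 2)⁻¹ *
          ((C - 2 * d * cmax ^ 2 * κ ^ 2 - amax * (Real.exp (2 * d * κ) - 1)) * ((S (lvl k') : ℝ) ^ 2)⁻¹)) := by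
  classical
  have hνpos : ∀ k, 0 < (C - 2 * d * cmax ^ 2 * κ ^ 2 - amax * (Real.exp (2 * d * κ) - 1)) * ((S (lvl k) : ℝ) ^ 2)⁻¹ :=
    fun k => mul_pos hμ (inv_pos.mpr (pow_pos (by exact_mod_cast hS (lvl k)) 2))
  have hthr := sdist_corner_thresholds S hS hdivS lvl zc hdisj hcover
  exact norm_sandwich_inv_le_siteBlock (cmat _) (fun p : UT N × Cp => cellOf S hS hdivS lvl zc hcover p.1)
    (fun k k' => sdist bsrc btgt (siteScale S hS hdivS lvl zc hcover) (ctrU N (S (lvl k)) (zc k)) (ctrU N (S (lvl k')) (zc k')))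
    (fun k' p => sdist bsrc btgt (siteScale S hS hdivS lvl zc hcover) p.1 (ctrU N (S (lvl k')) (zc k'))) (2 * d)
    (fun k' p hp => (hthr p.1 k').1 hp) (fun k k' p hp => by have h := (hthr p.1 k').2; rw [hp] at h; exact h) q hq hNq hκ0
    (ν := fun k => (C - 2 * d * cmax ^ 2 * κ ^ 2 - amax * (Real.exp (2 * d * κ) - 1)) * ((S (lvl k) : ℝ) ^ 2)⁻¹) hνpos
    (fun k' z => localConjCoercive_cmat_levelOp S hS hdivS lvl zc hdisj hcover Rm hRm T hT a ha ω hsupp hamax hscale c hc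
      hcoer hκ0 hκ1 (ctrU N (S (lvl k')) (zc k')) z) k k'

/-- **WEIGHTED ROW SUMS of the cell-lattice sandwich (the (2.16)-currency hand-off).**  Same setting; `S_l ≤ S_max` (the TOP scale)
and a cell-lattice profile `Σ_{k′} e^{−(κ−κ′)·d_n(t_k, t_{k′})} ≤ L`.  Then
`WRS κ′ (d_n on corners) (sandwich (cmat levelOp) q) (Nq∕(μ₀S_max⁻²)·e^{2κ·2d}·L)` — §3 with the floor at the top scale; in
units `S_max = 1` the bound is `Nq·e^{4κd}·L∕μ₀`, `k`-uniform (the row owner's RowData junction (α) starts here).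
[cite: Balaban1988RG2Cluster, (2.16) p.16] [folklore] -/
theorem wrs_cellSandwich_levelOp (hμ : 0 < C - 2 * d * cmax ^ 2 * κ ^ 2 - amax * (Real.exp (2 * d * κ) - 1))
    {Smax : ℕ} (hSmax1 : 1 ≤ Smax) (hSmax : ∀ l, S l ≤ Smax)
    (q : K → UT N × Cp → ℂ) (hq : ∀ k p, cellOf S hS hdivS lvl zc hcover p.1 ≠ k → q k p = 0) {Nq : ℝ} (hNq0 : 0 ≤ Nq)
    (hNq : ∀ k, nsq (q k) ≤ Nq) {κ' L : ℝ}
    (hL : ∀ k, ∑ k', Real.exp (-((κ - κ') * sdist bsrc btgt (siteScale S hS hdivS lvl zc hcover)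
      (ctrU N (S (lvl k)) (zc k)) (ctrU N (S (lvl k')) (zc k')))) ≤ L) :
    WRS κ' (fun k k' => sdist bsrc btgt (siteScale S hS hdivS lvl zc hcover) (ctrU N (S (lvl k)) (zc k))
        (ctrU N (S (lvl k')) (zc k')))
      (sandwich (cmat (levelOp bsrc btgt c Rm (fun l x => ctrU N (S l) (tblk (hS l) (hdivS l) x))
        (fun l x => ω l (ctrU N (S l) (tblk (hS l) (hdivS l) x))) T a)) q)
      (Nq / ((C - 2 * d * cmax ^ 2 * κ ^ 2 - amax * (Real.exp (2 * d * κ) - 1)) * ((Smax : ℝ) ^ 2)⁻¹) *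
        Real.exp (2 * κ * (2 * d)) * L) := by
  classical
  have hthr := sdist_corner_thresholds S hS hdivS lvl zc hdisj hcover
  have hSpos : ∀ k, (0 : ℝ) < S (lvl k) := fun k => by exact_mod_cast hS (lvl k)
  have hSm : (0 : ℝ) < Smax := by exact_mod_cast hSmax1
  have hν0 : 0 < (C - 2 * d * cmax ^ 2 * κ ^ 2 - amax * (Real.exp (2 * d * κ) - 1)) * ((Smax : ℝ) ^ 2)⁻¹ :=
    mul_pos hμ (inv_pos.mpr (pow_pos hSm 2))
  have hfl : ∀ k, (C - 2 * d * cmax ^ 2 * κ ^ 2 - amax * (Real.exp (2 * d * κ) - 1)) * ((Smax : ℝ) ^ 2)⁻¹ ≤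
      (C - 2 * d * cmax ^ 2 * κ ^ 2 - amax * (Real.exp (2 * d * κ) - 1)) * ((S (lvl k) : ℝ) ^ 2)⁻¹ := fun k =>
    mul_le_mul_of_nonneg_left (inv_anti₀ (pow_pos (hSpos k) 2)
      (pow_le_pow_left₀ (hSpos k).le (by exact_mod_cast hSmax (lvl k)) 2)) hμ.le
  exact wrs_sandwich_inv_siteFloor (cmat _) (fun p : UT N × Cp => cellOf S hS hdivS lvl zc hcover p.1)
    (fun k k' => sdist bsrc btgt (siteScale S hS hdivS lvl zc hcover) (ctrU N (S (lvl k)) (zc k)) (ctrU N (S (lvl k')) (zc k')))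
    (fun k' p => sdist bsrc btgt (siteScale S hS hdivS lvl zc hcover) p.1 (ctrU N (S (lvl k')) (zc k'))) (2 * d)
    (fun k' p hp => (hthr p.1 k').1 hp) (fun k k' p hp => by have h := (hthr p.1 k').2; rw [hp] at h; exact h) q hq hNq0 hNq
    hκ0 hν0 hfl
    (fun k' z => localConjCoercive_cmat_levelOp S hS hdivS lvl zc hdisj hcover Rm hRm T hT a ha ω hsupp hamax hscale c hc
      hcoer hκ0 hκ1 (ctrU N (S (lvl k')) (zc k')) z) hL

end Instance

end

end Summit.QuantumFields.BalabanUV.Beta.AccretiveCombesThomasSandwichSite
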